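import Mathlib
import Literature.RingTheory.MvPolynomial.MultihomogeneousBezoutExistence

/-!
# Chains of lines on intersections of hypersurfaces of low degree: any two points of
# `V(F_1, …, F_c) ⊆ ℙᴺ` with `Σ deg F_a ≤ N - 1` are joined by a chain of lines

Topic: `Literature/RingTheory/MvPolynomial`. Over an algebraically closed field `L`, let
`F_a` (`a < c`) be forms of degrees `d_a ≥ 1` in `N + 1` variables with `Σ_a d_a + 1 ≤ N`, and let
`p, q ≠ 0` be common zeros. **Then there is a chain `p = v_0, v_1, …, v_{r+1} = q` of non-zero
vectors such that every `F_a` vanishes identically on each span `s·v_j + t·v_{j+1}`**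
(`exists_chain_of_sum_deg_le`): the zero set `X = V₊(F) ⊆ ℙᴺ` is chain connected by lines, in the
exact algebraic form consumed by
`Literature.AlgebraicGeometry.Motives.isTorsion_chowGroupOne_quot_lineClasses_of_chain`
(hypothesis `hchain`). This is the rational chain connectedness by lines of complete intersections
of degree `Σ d_a ≤ N - 1` (Kollár, *Rational Curves on Algebraic Varieties*, V.4.8.1, as invoked in
Tian–Zong, *One-cycles on rationally connected varieties*, Compositio Math. 150 (2014), proof of
Thm. 6.1), here for every (possibly singular or reducible) `V₊(F)` and with the explicit bound
`r = Σ_a (d_a - 1) + 1` on the number of intermediate points.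

## Proof: the chain scheme is a multihomogeneous system with positive Bézout number

With `B = Σ_a (d_a - 1) + 1` unknown intermediate points `m_1, …, m_B ∈ ℙᴺ` (the blocks of a
multihomogeneous system on `(ℙᴺ)^B`) and `m_0 = p`, `m_{B+1} = q`, the conditions are:
`F_a(m_b) = 0` (degree `d_a` on block `b`) and, for each of the `B + 1` links, the vanishing of the
mixed coefficients `Φ_{a,j}` (`1 ≤ j ≤ d_a - 1`, bidegree `(d_a - j, j)`) of the binary form
`F_a(s·m_i + t·m_{i+1})` (`twoPointSubst`): a binary form of degree `d ≥ 1` vanishing at `(1,0)` and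
`(0,1)` whose mixed coefficients vanish is zero (`eval_smul_add_smul_eq_zero_of_coeff`). Enumerate
the `δ = Σ_a (d_a - 1)` mixed types `τ`; block `b` is charged with `F_a(m_b)` (`c` equations), with
the type-`τ` equation of link `b` (to its left) when `τ ≥ b` and of link `b + 1` (to its right) when
`τ < b`, and with the type-`b` equation of link `b + 1`: every equation of every link is charged to
one of its two blocks with positive degree there, and each block carries `c + δ + 1 = Σ_a d_a + 1 ≤ N`
equations against `N + 1` homogeneous coordinates — the load condition of the multihomogeneous
Bézout existence theorem `Literature.RingTheory.MvPolynomial.exists_common_zero_of_assignment`.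
Its common zero is the chain.

## References

* J. Kollár, *Rational Curves on Algebraic Varieties*, Springer 1996, V.4.8.1.
* Z. Tian, H. R. Zong, *One-cycles on rationally connected varieties*, Compositio Math. 150 (2014),
  396–408, proof of Thm. 6.1 (first sentence) and proof of Prop. 7.2 (equations of chains of
  lines). [TianZong2014]
* A. P. Morgan, A. J. Sommese, Appl. Math. Comput. 24 (1987) 101–113, Thm. 1. [MorganSommese1987]
-/

noncomputable section

open MvPolynomial Finset

namespace Literature.RingTheory.MvPolynomial

universe u

/-! ## Weighted homogeneity under substitution -/

section Subst

variable {L : Type u} [CommRing L] {τ V : Type*} {M : Type*} [AddCommMonoid M]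

/-- Substituting weighted-homogeneous polynomials of a common weight `cw` into a form of degree `d`
gives a weighted-homogeneous polynomial of weight `d • cw`. [folklore] -/
theorem isWeightedHomogeneous_aeval_of_isHomogeneous (w : V → M) (g : τ → MvPolynomial V L)
    (cw : M) (hg : ∀ m, (g m).IsWeightedHomogeneous w cw) {F : MvPolynomial τ L} {d : ℕ}
    (hF : F.IsHomogeneous d) :
    (aeval g F).IsWeightedHomogeneous w (d • cw) := by
  classical
  rw [aeval_def, MvPolynomial.eval₂_eq]
  refine IsWeightedHomogeneous.sum _ _ _ fun s hs => ?_
  have hsd : s.degree = d := by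
    rw [Finsupp.degree_eq_weight_one]; exact hF (mem_support_iff.mp hs)
  have hprod : (∏ i ∈ s.support, g i ^ s i).IsWeightedHomogeneous w (∑ i ∈ s.support, s i • cw) :=
    IsWeightedHomogeneous.prod _ _ _ fun i _ => (hg i).pow _
  have hsum : ∑ i ∈ s.support, s i • cw = d • cw := by
    rw [← Finset.sum_smul, ← hsd]; rfl
  have hC : (algebraMap L (MvPolynomial V L) (coeff s F)).IsWeightedHomogeneous w 0 :=
    isWeightedHomogeneous_C _ _
  have h := hC.mul hprod
  rwa [zero_add, hsum] at h

/-- `aeval` computed pointwise after evaluation: `(aeval g F)(z) = F((g m)(z))_m`. [folklore] -/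
theorem eval_aeval_eq_eval_comp (g : τ → MvPolynomial V L) (F : MvPolynomial τ L) (z : V → L) :
    eval z (aeval g F) = eval (fun m => eval z (g m)) F := by
  induction F using MvPolynomial.induction_on with
  | C a => simp
  | add p q hp hq => simp only [map_add, hp, hq]
  | mul_X p m hp => simp only [map_mul, aeval_X, hp, eval_X]

/-! ## The two-point span substitution `F ↦ F(s·u + t·v)` -/

/-- **The two-point span substitution**: for families `u = (gL m)_m`, `v = (gR m)_m` of polynomials
in auxiliary variables `V`, the algebra map `F ↦ F(s·u + t·v)`, a polynomial in `(s, t) = (Y₀, Y₁)`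
whose coefficients `Φ_e(u, v)` are polynomials in `V`: the bihomogeneous components of `F` along the
line spanned by `u` and `v` (Tian–Zong, proof of Prop. 7.2: "just consider the equations for the
intersection point of the two lines"). [cite: TianZong2014, proof of Prop. 7.2] -/
def twoPointSubst (gL gR : τ → MvPolynomial V L) :
    MvPolynomial τ L →ₐ[L] MvPolynomial (Fin 2) (MvPolynomial V L) :=
  aeval fun m => X 0 * C (gL m) + X 1 * C (gR m)

/-- Unfolding lemma. [folklore] -/
theorem twoPointSubst_apply (gL gR : τ → MvPolynomial V L) (F : MvPolynomial τ L) :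
    twoPointSubst gL gR F = aeval (fun m => X 0 * C (gL m) + X 1 * C (gR m)) F := rfl

/-- On a variable: `twoPointSubst gL gR (X m) = Y₀ · gL m + Y₁ · gR m`. [folklore] -/
@[simp] theorem twoPointSubst_X (gL gR : τ → MvPolynomial V L) (m : τ) :
    twoPointSubst gL gR (X m) = X 0 * C (gL m) + X 1 * C (gR m) := by
  rw [twoPointSubst_apply, aeval_X]

/-- On a constant. [folklore] -/
@[simp] theorem twoPointSubst_C (gL gR : τ → MvPolynomial V L) (a : L) :
    twoPointSubst gL gR (C a) = C (C a) := by
  rw [twoPointSubst_apply, aeval_C]; rfl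

/-- **The coefficients of `F(s·u + t·v)` are weighted homogeneous**: if all `gL m` have weight `wL`
and all `gR m` have weight `wR`, the coefficient of `s^{e₀} t^{e₁}` has weight `e₀ • wL + e₁ • wR`.
[folklore] -/
theorem isWeightedHomogeneous_coeff_twoPointSubst (w : V → M) {gL gR : τ → MvPolynomial V L}
    {wL wR : M} (hL : ∀ m, (gL m).IsWeightedHomogeneous w wL)
    (hR : ∀ m, (gR m).IsWeightedHomogeneous w wR) (F : MvPolynomial τ L) (e : Fin 2 →₀ ℕ) :
    (coeff e (twoPointSubst gL gR F)).IsWeightedHomogeneous w (e 0 • wL + e 1 • wR) := by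
  classical
  induction F using MvPolynomial.induction_on generalizing e with
  | C a =>
    rw [twoPointSubst_C, coeff_C]
    split_ifs with h
    · subst h
      simp only [Finsupp.coe_zero, Pi.zero_apply, zero_smul, add_zero]
      exact isWeightedHomogeneous_C _ _
    · exact isWeightedHomogeneous_zero _ _ _
  | add p q hp hq =>
    rw [map_add, coeff_add]
    exact (hp e).add (hq e)
  | mul_X p m hp =>
    have hexp : twoPointSubst gL gR p * (X 0 * C (gL m) + X 1 * C (gR m)) =
        C (gL m) * (twoPointSubst gL gR p * X 0) + C (gR m) * (twoPointSubst gL gR p * X 1) := by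
      ring
    rw [map_mul, twoPointSubst_X, hexp, coeff_add, coeff_C_mul, coeff_C_mul, coeff_mul_X',
      coeff_mul_X']
    refine IsWeightedHomogeneous.add ?_ ?_
    · by_cases h0 : (0 : Fin 2) ∈ e.support
      · rw [if_pos h0]
        have h1 : 1 ≤ e 0 := Nat.one_le_iff_ne_zero.mpr (Finsupp.mem_support_iff.mp h0)
        have h := (hL m).mul (hp (e - Finsupp.single 0 1))
        have heq : wL + ((e - Finsupp.single 0 1 : Fin 2 →₀ ℕ) 0 • wL +
            (e - Finsupp.single 0 1 : Fin 2 →₀ ℕ) 1 • wR) =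
            e 0 • wL + e 1 • wR := by
          simp only [Finsupp.tsub_apply, Finsupp.single_eq_same, Finsupp.single_eq_of_ne
            (show (1 : Fin 2) ≠ 0 from one_ne_zero), tsub_zero]
          rw [← add_assoc, add_comm wL ((e 0 - 1) • wL), ← succ_nsmul, Nat.sub_add_cancel h1]
        rwa [heq] at h
      · rw [if_neg h0, mul_zero]; exact isWeightedHomogeneous_zero _ _ _
    · by_cases h0 : (1 : Fin 2) ∈ e.support
      · rw [if_pos h0]
        have h1 : 1 ≤ e 1 := Nat.one_le_iff_ne_zero.mpr (Finsupp.mem_support_iff.mp h0)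
        have h := (hR m).mul (hp (e - Finsupp.single 1 1))
        have heq : wR + ((e - Finsupp.single 1 1 : Fin 2 →₀ ℕ) 0 • wL +
            (e - Finsupp.single 1 1 : Fin 2 →₀ ℕ) 1 • wR) =
            e 0 • wL + e 1 • wR := by
          simp only [Finsupp.tsub_apply, Finsupp.single_eq_same, Finsupp.single_eq_of_ne
            (show (0 : Fin 2) ≠ 1 from zero_ne_one), tsub_zero]
          rw [add_comm wR, add_assoc, ← succ_nsmul, Nat.sub_add_cancel h1]
        rwa [heq] at h
      · rw [if_neg h0, mul_zero]; exact isWeightedHomogeneous_zero _ _ _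

/-- **Evaluation of the two-point substitution**: `F(s·u + t·v)` at `(s, t)`, after evaluating the
auxiliary variables at `z`, is `F` at the vector `s·u(z) + t·v(z)`. [folklore] -/
theorem eval_map_twoPointSubst (gL gR : τ → MvPolynomial V L) (F : MvPolynomial τ L) (z : V → L)
    (st : Fin 2 → L) :
    eval st (MvPolynomial.map (eval z) (twoPointSubst gL gR F)) =
      eval (fun m => st 0 * eval z (gL m) + st 1 * eval z (gR m)) F := by
  induction F using MvPolynomial.induction_on with
  | C a => simp
  | add p q hp hq => simp only [map_add, hp, hq]
  | mul_X p m hp =>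
    simp only [map_mul, twoPointSubst_X, hp, eval_X, map_add, map_X, map_C, eval_C]

/-- `F(s·u + t·v)` is a binary form of degree `deg F` in `(s, t)`. [folklore] -/
theorem isHomogeneous_twoPointSubst (gL gR : τ → MvPolynomial V L) {F : MvPolynomial τ L} {d : ℕ}
    (hF : F.IsHomogeneous d) : (twoPointSubst gL gR F).IsHomogeneous d := by
  have hg : ∀ m, (X 0 * C (gL m) + X 1 * C (gR m) :
      MvPolynomial (Fin 2) (MvPolynomial V L)).IsHomogeneous 1 := fun m => by
    have h := ((isHomogeneous_X (MvPolynomial V L) (0 : Fin 2)).mul (isHomogeneous_C _ (gL m))).add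
      ((isHomogeneous_X (MvPolynomial V L) (1 : Fin 2)).mul (isHomogeneous_C _ (gR m)))
    simpa using h
  have h := hF.eval₂ (algebraMap L (MvPolynomial (Fin 2) (MvPolynomial V L)))
    (fun m => X 0 * C (gL m) + X 1 * C (gR m)) (fun r => by
      rw [MvPolynomial.algebraMap_apply]; exact isHomogeneous_C _ _) hg
  rw [one_mul] at h
  exact h

end Subst

/-! ## Binary forms with vanishing mixed coefficients -/

section Binary

variable {L : Type u} [Field L]

/-- A form of degree `d` evaluated at the coordinate vector `e_i` is its coefficient at `X_i^d`.
[folklore] -/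
theorem eval_pi_single_of_isHomogeneous {σ : Type*} [Fintype σ] [DecidableEq σ]
    {P : MvPolynomial σ L} {d : ℕ} (hP : P.IsHomogeneous d) (i : σ) :
    eval (Pi.single i 1 : σ → L) P = coeff (Finsupp.single i d) P := by
  classical
  rw [MvPolynomial.eval_eq]
  rw [Finset.sum_eq_single (Finsupp.single i d)]
  · rw [Finset.prod_eq_one, mul_one]
    intro j hj
    have hji : j = i := by
      have := Finsupp.support_single_subset hj
      rwa [Finset.mem_singleton] at this
    subst hji
    rw [Pi.single_eq_same, one_pow]
  · intro e he hne
    by_cases h : ∃ j, j ≠ i ∧ e j ≠ 0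
    · obtain ⟨j, hji, hj⟩ := h
      apply mul_eq_zero_of_right
      exact Finset.prod_eq_zero (Finsupp.mem_support_iff.mpr hj)
        (by rw [Pi.single_eq_of_ne hji, zero_pow hj])
    · exfalso
      apply hne
      have hdeg : e.degree = d := by
        rw [Finsupp.degree_eq_weight_one]; exact hP (mem_support_iff.mp he)
      have he' : e = Finsupp.single i (e i) := by
        ext j
        by_cases hji : j = i
        · subst hji; rw [Finsupp.single_eq_same]
        · rw [Finsupp.single_eq_of_ne hji]
          by_contra hj
          exact h ⟨j, hji, hj⟩
      have hei : e i = d := by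
        rw [← hdeg, he', Finsupp.degree_single, Finsupp.single_eq_same]
      rw [he', hei]
  · intro hnot
    rw [notMem_support_iff.mp hnot, zero_mul]

/-- **A binary form that vanishes at `(1, 0)` and `(0, 1)` and has vanishing mixed coefficients is
zero.** [folklore] -/
theorem eq_zero_of_isHomogeneous_fin_two {P : MvPolynomial (Fin 2) L} {d : ℕ}
    (hP : P.IsHomogeneous d)
    (hmixed : ∀ e : Fin 2 →₀ ℕ, 1 ≤ e 0 → 1 ≤ e 1 → coeff e P = 0)
    (h0 : eval (Pi.single 0 1 : Fin 2 → L) P = 0) (h1 : eval (Pi.single 1 1 : Fin 2 → L) P = 0) :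
    P = 0 := by
  classical
  rw [eval_pi_single_of_isHomogeneous hP] at h0 h1
  ext e
  rw [coeff_zero]
  by_contra hne
  have hdeg : e.degree = d := by
    rw [Finsupp.degree_eq_weight_one]; exact hP hne
  have hdeg' : e 0 + e 1 = d := by
    rw [← hdeg, Finsupp.degree_eq_sum, Fin.sum_univ_two]
  by_cases he0 : 1 ≤ e 0
  · by_cases he1 : 1 ≤ e 1
    · exact hne (hmixed e he0 he1)
    · have he1' : e 1 = 0 := by omega
      have : e = Finsupp.single 0 d := by
        ext j; fin_cases j
        · simp only [Fin.zero_eta, Finsupp.single_eq_same]; omega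
        · simp only [Fin.mk_one, ne_eq, one_ne_zero, not_false_eq_true,
            Finsupp.single_eq_of_ne]; exact he1'
      rw [this] at hne
      exact hne h0
  · have he0' : e 0 = 0 := by omega
    have : e = Finsupp.single 1 d := by
      ext j; fin_cases j
      · simp only [Fin.zero_eta, ne_eq, zero_ne_one, not_false_eq_true,
          Finsupp.single_eq_of_ne]; exact he0'
      · simp only [Fin.mk_one, Finsupp.single_eq_same]; omega
    rw [this] at hne
    exact hne h1

/-- **Lines from vanishing coefficients.** If a form `F` vanishes at `u(z)` and at
`v(z)` and all mixed coefficients of `F(s·u + t·v)` vanish at `z`, then `F` vanishes identically on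
the span of `u(z)` and `v(z)`. [folklore] -/
theorem eval_smul_add_smul_eq_zero_of_coeff {τ V : Type*} (gL gR : τ → MvPolynomial V L)
    {F : MvPolynomial τ L} {d : ℕ} (hF : F.IsHomogeneous d) (z : V → L)
    (hmixed : ∀ e : Fin 2 →₀ ℕ, 1 ≤ e 0 → 1 ≤ e 1 → eval z (coeff e (twoPointSubst gL gR F)) = 0)
    (hu : eval (fun m => eval z (gL m)) F = 0) (hv : eval (fun m => eval z (gR m)) F = 0)
    (s t : L) :
    eval (fun m => s * eval z (gL m) + t * eval z (gR m)) F = 0 := by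
  classical
  set P := MvPolynomial.map (eval z) (twoPointSubst gL gR F) with hPdef
  have hP : P.IsHomogeneous d := (isHomogeneous_twoPointSubst gL gR hF).map _
  have hP0 : P = 0 := by
    refine eq_zero_of_isHomogeneous_fin_two hP (fun e he0 he1 => ?_) ?_ ?_
    · rw [hPdef, coeff_map]; exact hmixed e he0 he1
    · rw [hPdef, eval_map_twoPointSubst]
      simpa using hu
    · rw [hPdef, eval_map_twoPointSubst]
      simpa using hv
  have h := eval_map_twoPointSubst gL gR F z ![s, t]
  rw [← hPdef, hP0, map_zero] at h
  simpa using h.symm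

end Binary

/-! ## The chain system -/

section ChainSystem

variable {L : Type u} [CommRing L] {N c : ℕ}

/-- **The points of a prospective chain** `p = m_0, m_1, …, m_B, m_{B+1} = q` as families of
polynomials in the unknown intermediate points (`B` blocks of `N + 1` variables): `m_0 = p` and
`m_k = q` for `k ≥ B + 1` are constants, `m_k = (X_{(k-1, m)})_m` for `1 ≤ k ≤ B`. [folklore] -/
def chainPt (p q : Fin (N + 1) → L) (B : ℕ) (k : ℕ) (m : Fin (N + 1)) :
    MvPolynomial (Fin B × Fin (N + 1)) L :=
  if k = 0 then C (p m) else if h : k - 1 < B then X (⟨k - 1, h⟩, m) else C (q m)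

/-- The block weight of the `k`-th point: `0` for the constant end points, `e_{k-1}` for the
unknown points. [folklore] -/
def chainWt (B k : ℕ) : Fin B → ℕ :=
  if k = 0 then 0 else if h : k - 1 < B then Pi.single ⟨k - 1, h⟩ 1 else 0

/-- The `0`-th point is the constant `p`. [folklore] -/
theorem chainPt_zero (p q : Fin (N + 1) → L) (B : ℕ) (m : Fin (N + 1)) :
    chainPt p q B 0 m = C (p m) := by
  simp [chainPt]

/-- The points `1 ≤ k ≤ B` are the unknown blocks. [folklore] -/
theorem chainPt_mid (p q : Fin (N + 1) → L) {B k : ℕ} (hk : 1 ≤ k) (hkB : k - 1 < B)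
    (m : Fin (N + 1)) : chainPt p q B k m = X (⟨k - 1, hkB⟩, m) := by
  rw [chainPt, if_neg (by omega), dif_pos hkB]

/-- The points `k ≥ B + 1` are the constant `q`. [folklore] -/
theorem chainPt_last (p q : Fin (N + 1) → L) {B k : ℕ} (hk : B + 1 ≤ k) (m : Fin (N + 1)) :
    chainPt p q B k m = C (q m) := by
  rw [chainPt, if_neg (by omega), dif_neg (by omega)]

/-- The points `k ≥ B + 1` are the constant `q` (negated-hypothesis form). [folklore] -/
theorem chainPt_last' (p q : Fin (N + 1) → L) {B k : ℕ} (hk : k ≠ 0) (hkB : ¬ k - 1 < B)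
    (m : Fin (N + 1)) : chainPt p q B k m = C (q m) := by
  rw [chainPt, if_neg hk, dif_neg hkB]

/-- The end point `p` carries no block. [folklore] -/
theorem chainWt_zero (B : ℕ) : chainWt B 0 = 0 := by
  simp [chainWt]

/-- The unknown point `k` has block weight `e_{k-1}`. [folklore] -/
theorem chainWt_mid {B k : ℕ} (hk : k ≠ 0) (hkB : k - 1 < B) :
    chainWt B k = Pi.single ⟨k - 1, hkB⟩ 1 := by
  rw [chainWt, if_neg hk, dif_pos hkB]

/-- The end point `q` carries no block. [folklore] -/
theorem chainWt_last {B k : ℕ} (hk : k ≠ 0) (hkB : ¬ k - 1 < B) : chainWt B k = 0 := by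
  rw [chainWt, if_neg hk, dif_neg hkB]

/-- The `k`-th point is multihomogeneous of weight `chainWt B k`. [folklore] -/
theorem isWeightedHomogeneous_chainPt (p q : Fin (N + 1) → L) (B k : ℕ) (m : Fin (N + 1)) :
    (chainPt p q B k m).IsWeightedHomogeneous
      (fun v : Fin B × Fin (N + 1) => (Pi.single v.1 1 : Fin B → ℕ)) (chainWt B k) := by
  by_cases h0 : k = 0
  · subst h0
    rw [chainPt_zero, chainWt_zero]; exact isWeightedHomogeneous_C _ _
  · by_cases h1 : k - 1 < B
    · rw [chainPt_mid p q (Nat.one_le_iff_ne_zero.mpr h0) h1, chainWt_mid h0 h1]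
      exact isWeightedHomogeneous_X_blockWeight (R := L)
        (Prod.fst : Fin B × Fin (N + 1) → Fin B) ((⟨k - 1, h1⟩ : Fin B), m)
    · rw [chainPt_last' p q h0 h1, chainWt_last h0 h1]; exact isWeightedHomogeneous_C _ _

/-- The block weight of point `k` at its own block is `1`. [folklore] -/
theorem chainWt_left {B k : ℕ} (hk : 1 ≤ k) (hkB : k - 1 < B) : chainWt B k ⟨k - 1, hkB⟩ = 1 := by
  rw [chainWt, if_neg (by omega), dif_pos hkB, Pi.single_eq_same]

/-- The block weight of point `k + 1` at block `k` is `1`. [folklore] -/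
theorem chainWt_right {B k : ℕ} (hk : k < B) : chainWt B (k + 1) ⟨k, hk⟩ = 1 := by
  have h1 : k + 1 - 1 < B := by simpa using hk
  rw [chainWt, if_neg (by omega), dif_pos h1]
  have : (⟨k + 1 - 1, h1⟩ : Fin B) = ⟨k, hk⟩ := Fin.ext (by simp)
  rw [this, Pi.single_eq_same]

/-- **The mixed equation of type `τ = (a, j')` of link `i`**: the coefficient of
`s^{d_a - 1 - j'} t^{j' + 1}` in `F_a(s·m_i + t·m_{i+1})` (`0 ≤ j' ≤ d_a - 2`, i.e. the mixed
coefficients `Φ_{a,j}`, `1 ≤ j ≤ d_a - 1`). [cite: TianZong2014, proof of Prop. 7.2] -/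
def mixedEq (F : Fin c → MvPolynomial (Fin (N + 1)) L) (d : Fin c → ℕ) (p q : Fin (N + 1) → L)
    (B i : ℕ) (τ : Σ a : Fin c, Fin (d a - 1)) : MvPolynomial (Fin B × Fin (N + 1)) L :=
  coeff (Finsupp.single 0 (d τ.1 - 1 - τ.2) + Finsupp.single 1 ((τ.2 : ℕ) + 1))
    (twoPointSubst (chainPt p q B i) (chainPt p q B (i + 1)) (F τ.1))

/-- The multidegree of the mixed equation of type `τ` of link `i`: `(d_a - 1 - j')` on the block of
`m_i` plus `(j' + 1)` on the block of `m_{i+1}` (end points carry no block). [folklore] -/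
def mixedWt (d : Fin c → ℕ) (B i : ℕ) (τ : Σ a : Fin c, Fin (d a - 1)) : Fin B → ℕ :=
  (d τ.1 - 1 - τ.2) • chainWt B i + ((τ.2 : ℕ) + 1) • chainWt B (i + 1)

/-- The mixed equations are multihomogeneous of multidegree `mixedWt`. [folklore] -/
theorem isWeightedHomogeneous_mixedEq (F : Fin c → MvPolynomial (Fin (N + 1)) L) (d : Fin c → ℕ)
    (p q : Fin (N + 1) → L) (B i : ℕ) (τ : Σ a : Fin c, Fin (d a - 1)) :
    (mixedEq F d p q B i τ).IsWeightedHomogeneous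
      (fun v : Fin B × Fin (N + 1) => (Pi.single v.1 1 : Fin B → ℕ)) (mixedWt d B i τ) := by
  classical
  have h := isWeightedHomogeneous_coeff_twoPointSubst
    (fun v : Fin B × Fin (N + 1) => (Pi.single v.1 1 : Fin B → ℕ))
    (isWeightedHomogeneous_chainPt p q B i) (isWeightedHomogeneous_chainPt p q B (i + 1)) (F τ.1)
    (Finsupp.single 0 (d τ.1 - 1 - τ.2) + Finsupp.single 1 ((τ.2 : ℕ) + 1))
  unfold mixedEq mixedWt
  simpa [Finsupp.single_apply] using h

/-- A mixed equation of link `i` has positive degree on the block of its left point `m_i`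
(when that point is unknown). [folklore] -/
theorem mixedWt_left (d : Fin c → ℕ) {B i : ℕ} (hi : 1 ≤ i) (hiB : i - 1 < B)
    (τ : Σ a : Fin c, Fin (d a - 1)) : 1 ≤ mixedWt d B i τ ⟨i - 1, hiB⟩ := by
  rw [mixedWt, Pi.add_apply, Pi.smul_apply, Pi.smul_apply, chainWt_left hi hiB]
  simp only [smul_eq_mul, mul_one]
  have := τ.2.isLt
  omega

/-- A mixed equation of link `i` has positive degree on the block of its right point `m_{i+1}`
(when that point is unknown). [folklore] -/
theorem mixedWt_right (d : Fin c → ℕ) {B i : ℕ} (hi : i < B) (τ : Σ a : Fin c, Fin (d a - 1)) :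
    1 ≤ mixedWt d B i τ ⟨i, hi⟩ := by
  rw [mixedWt, Pi.add_apply, Pi.smul_apply, Pi.smul_apply, chainWt_right hi]
  simp only [smul_eq_mul, mul_one]
  omega

/-- **The chain system, charged block by block.** The equations carried by block `b`, indexed by
the slots `Fin c ⊕ Option T` (`T` the mixed types, enumerated by `enum : T ≃ Fin δ`): slot `a` is
`F_a(m_{b+1})`; slot `some τ` is the type-`τ` mixed equation of the link to the left of the block
when `enum τ ≥ b` and of the link to its right when `enum τ < b`; slot `none` is the type-`b` mixed
equation of the link to the right (the zero polynomial for the last block). [folklore] -/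
def chainSysEq (F : Fin c → MvPolynomial (Fin (N + 1)) L) (d : Fin c → ℕ) (p q : Fin (N + 1) → L)
    (B : ℕ) {δt : ℕ} (enum : (Σ a : Fin c, Fin (d a - 1)) ≃ Fin δt)
    (j : Fin B × (Fin c ⊕ Option (Σ a : Fin c, Fin (d a - 1)))) :
    MvPolynomial (Fin B × Fin (N + 1)) L :=
  Sum.elim (fun a => aeval (fun m => X (j.1, m)) (F a))
    (fun o => Option.elim o
      (if h : (j.1 : ℕ) < δt then mixedEq F d p q B (j.1 + 1) (enum.symm ⟨j.1, h⟩) else 0)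
      (fun τ => if (j.1 : ℕ) ≤ enum τ then mixedEq F d p q B j.1 τ
        else mixedEq F d p q B (j.1 + 1) τ)) j.2

/-- The multidegrees of the chain system. [folklore] -/
def chainSysWt (d : Fin c → ℕ) (B : ℕ) {δt : ℕ} (enum : (Σ a : Fin c, Fin (d a - 1)) ≃ Fin δt)
    (j : Fin B × (Fin c ⊕ Option (Σ a : Fin c, Fin (d a - 1)))) : Fin B → ℕ :=
  Sum.elim (fun a => (Pi.single j.1 (d a) : Fin B → ℕ))
    (fun o => Option.elim o
      (if h : (j.1 : ℕ) < δt then mixedWt d B (j.1 + 1) (enum.symm ⟨j.1, h⟩) else Pi.single j.1 1)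
      (fun τ => if (j.1 : ℕ) ≤ enum τ then mixedWt d B j.1 τ else mixedWt d B (j.1 + 1) τ)) j.2

/-- The chain system is multihomogeneous of the stated multidegrees. [folklore] -/
theorem isWeightedHomogeneous_chainSysEq {F : Fin c → MvPolynomial (Fin (N + 1)) L}
    {d : Fin c → ℕ} (hF : ∀ a, (F a).IsHomogeneous (d a)) (p q : Fin (N + 1) → L) (B : ℕ)
    {δt : ℕ} (enum : (Σ a : Fin c, Fin (d a - 1)) ≃ Fin δt)
    (j : Fin B × (Fin c ⊕ Option (Σ a : Fin c, Fin (d a - 1)))) :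
    (chainSysEq F d p q B enum j).IsWeightedHomogeneous
      (fun v : Fin B × Fin (N + 1) => (Pi.single v.1 1 : Fin B → ℕ)) (chainSysWt d B enum j) := by
  classical
  obtain ⟨b, a | _ | τ⟩ := j
  · show (aeval (fun m => X (b, m)) (F a)).IsWeightedHomogeneous _ (Pi.single b (d a) : Fin B → ℕ)
    have h := isWeightedHomogeneous_aeval_of_isHomogeneous
      (fun v : Fin B × Fin (N + 1) => (Pi.single v.1 1 : Fin B → ℕ)) (fun m => X (b, m))
      (Pi.single b 1) (fun m => isWeightedHomogeneous_X_blockWeight (R := L)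
        (Prod.fst : Fin B × Fin (N + 1) → Fin B) (b, m))
      (hF a)
    rwa [← Pi.single_smul', smul_eq_mul, mul_one] at h
  · show (if h : (b : ℕ) < δt then mixedEq F d p q B (b + 1) (enum.symm ⟨b, h⟩) else 0).IsWeightedHomogeneous
      _ (if h : (b : ℕ) < δt then mixedWt d B (b + 1) (enum.symm ⟨b, h⟩) else Pi.single b 1)
    split_ifs with h
    · exact isWeightedHomogeneous_mixedEq _ _ _ _ _ _ _
    · exact isWeightedHomogeneous_zero _ _ _
  · show (if (b : ℕ) ≤ enum τ then mixedEq F d p q B b τ else mixedEq F d p q B (b + 1) τ).IsWeightedHomogeneous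
      _ (if (b : ℕ) ≤ enum τ then mixedWt d B b τ else mixedWt d B (b + 1) τ)
    split_ifs
    · exact isWeightedHomogeneous_mixedEq _ _ _ _ _ _ _
    · exact isWeightedHomogeneous_mixedEq _ _ _ _ _ _ _

/-- Every equation of the chain system has positive degree on its own block. [folklore] -/
theorem one_le_chainSysWt {d : Fin c → ℕ} (hd : ∀ a, 0 < d a) {B δt : ℕ}
    (enum : (Σ a : Fin c, Fin (d a - 1)) ≃ Fin δt)
    (j : Fin B × (Fin c ⊕ Option (Σ a : Fin c, Fin (d a - 1)))) :
    1 ≤ chainSysWt d B enum j j.1 := by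
  classical
  obtain ⟨b, a | _ | τ⟩ := j
  · show 1 ≤ (Pi.single b (d a) : Fin B → ℕ) b
    rw [Pi.single_eq_same]; exact hd a
  · show 1 ≤ (if h : (b : ℕ) < δt then mixedWt d B (b + 1) (enum.symm ⟨b, h⟩) else Pi.single b 1) b
    have hb1 : (b : ℕ) + 1 - 1 < B := by simp
    have hb : (⟨(b : ℕ) + 1 - 1, hb1⟩ : Fin B) = b := Fin.ext (by simp)
    split_ifs with h
    · have := mixedWt_left d (B := B) (i := b + 1) (by omega) hb1 (enum.symm ⟨b, h⟩)
      rwa [hb] at this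
    · rw [Pi.single_eq_same]
  · show 1 ≤ (if (b : ℕ) ≤ enum τ then mixedWt d B b τ else mixedWt d B (b + 1) τ) b
    have hb1 : (b : ℕ) + 1 - 1 < B := by simp
    have hb : (⟨(b : ℕ) + 1 - 1, hb1⟩ : Fin B) = b := Fin.ext (by simp)
    split_ifs with h
    · exact mixedWt_right d b.isLt τ
    · have := mixedWt_left d (B := B) (i := b + 1) (by omega) hb1 τ
      rwa [hb] at this

/-- The chain system has `c + (δ + 1)` equations on each block. [folklore] -/
theorem card_filter_chainSys_fst_eq (d : Fin c → ℕ) (B : ℕ) {δt : ℕ}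
    (hT : Fintype.card (Σ a : Fin c, Fin (d a - 1)) = δt) (l : Fin B) :
    ((univ : Finset (Fin B × (Fin c ⊕ Option (Σ a : Fin c, Fin (d a - 1))))).filter
      (fun j => j.1 = l)).card = c + (δt + 1) := by
  classical
  rw [← Fintype.card_subtype]
  rw [show Fintype.card {j : Fin B × (Fin c ⊕ Option (Σ a : Fin c, Fin (d a - 1))) // j.1 = l} =
      Fintype.card (Fin c ⊕ Option (Σ a : Fin c, Fin (d a - 1))) from
    Fintype.card_congr
      { toFun := fun j => j.1.2
        invFun := fun x => ⟨(l, x), rfl⟩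
        left_inv := by rintro ⟨⟨b, x⟩, rfl⟩; rfl
        right_inv := fun x => rfl }]
  rw [Fintype.card_sum, Fintype.card_fin, Fintype.card_option, hT]

/-- A block of `(ℙᴺ)^B` has `N + 1` homogeneous coordinates. [folklore] -/
theorem card_filter_fst_eq (B N : ℕ) (l : Fin B) :
    ((univ : Finset (Fin B × Fin (N + 1))).filter (fun v => v.1 = l)).card = N + 1 := by
  classical
  rw [← Fintype.card_subtype]
  rw [show Fintype.card {v : Fin B × Fin (N + 1) // v.1 = l} = Fintype.card (Fin (N + 1)) from
    Fintype.card_congr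
      { toFun := fun v => v.1.2
        invFun := fun m => ⟨(l, m), rfl⟩
        left_inv := by rintro ⟨⟨b, m⟩, rfl⟩; rfl
        right_inv := fun m => rfl }]
  exact Fintype.card_fin _

end ChainSystem

/-! ## The theorem -/

section Chain

variable {L : Type u} [Field L] [IsAlgClosed L] {N c : ℕ}

/-- **Chain connectedness by lines, in coordinates, with the explicit length
`r = Σ_a (d_a - 1) + 1`** (Kollár V.4.8.1 for `Σ d_a ≤ N - 1`, over an algebraically closed field,
for every `V₊(F)`): if `F_a` are forms of degrees `d_a ≥ 1` in `N + 1` variables with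
`Σ_a d_a + 1 ≤ N`, any two non-zero common zeros `p, q` are joined by a chain
`p = v_0, v_1, …, v_{r+1} = q` of non-zero vectors, `r = Σ_a (d_a - 1) + 1`, with every `F_a`
vanishing identically on each span `s·v_j + t·v_{j+1}`. The chain is a common zero of the
multihomogeneous system of the links on `(ℙᴺ)^r`, which exists by the multihomogeneous Bézout
existence theorem. [cite: TianZong2014, proof of Thm. 6.1 (first sentence)] -/
theorem exists_chain_of_sum_deg_le_length {F : Fin c → MvPolynomial (Fin (N + 1)) L}
    {d : Fin c → ℕ} (hF : ∀ a, (F a).IsHomogeneous (d a)) (hd : ∀ a, 0 < d a)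
    (hN : ∑ a, d a + 1 ≤ N) (p q : Fin (N + 1) → L) (hp0 : p ≠ 0) (hq0 : q ≠ 0)
    (hp : ∀ a, eval p (F a) = 0) (hq : ∀ a, eval q (F a) = 0) :
    ∃ v : ℕ → Fin (N + 1) → L, v 0 = p ∧ v (∑ a, (d a - 1) + 1 + 1) = q ∧
      (∀ j ≤ ∑ a, (d a - 1) + 1 + 1, v j ≠ 0) ∧
      ∀ j ≤ ∑ a, (d a - 1) + 1, ∀ a (s t : L), eval (s • v j + t • v (j + 1)) (F a) = 0 := by
  classical
  -- sizes: `δt = Σ (d_a - 1)` mixed types, `B = δt + 1` intermediate points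
  obtain ⟨δt, hδt⟩ : ∃ δt, ∑ a, (d a - 1) = δt := ⟨_, rfl⟩
  rw [hδt]
  have hδc : δt + c = ∑ a, d a := by
    rw [← hδt]
    have h : ∑ a, (d a - 1 + 1) = ∑ a, d a :=
      Finset.sum_congr rfl fun a _ => Nat.sub_add_cancel (hd a)
    rw [← h, Finset.sum_add_distrib, Finset.sum_const, Finset.card_univ, Fintype.card_fin,
      smul_eq_mul, mul_one]
  obtain ⟨B, hB⟩ : ∃ B, δt + 1 = B := ⟨_, rfl⟩
  rw [hB]
  have hT : Fintype.card (Σ a : Fin c, Fin (d a - 1)) = δt := by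
    rw [Fintype.card_sigma, ← hδt]
    exact Finset.sum_congr rfl fun a _ => Fintype.card_fin _
  let enum : (Σ a : Fin c, Fin (d a - 1)) ≃ Fin δt :=
    Fintype.equivOfCardEq (by rw [hT, Fintype.card_fin])
  -- solve the chain system
  have hload : ∀ l : Fin B,
      ((univ : Finset (Fin B × (Fin c ⊕ Option (Σ a : Fin c, Fin (d a - 1))))).filter
        (fun j => j.1 = l)).card + 1 ≤
      ((univ : Finset (Fin B × Fin (N + 1))).filter (fun v => v.1 = l)).card := by
    intro l
    rw [card_filter_chainSys_fst_eq d B hT, card_filter_fst_eq]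
    omega
  obtain ⟨z, hzblk, hzQ⟩ := exists_common_zero_of_assignment Prod.fst (chainSysEq F d p q B enum)
    (chainSysWt d B enum) (isWeightedHomogeneous_chainSysEq hF p q B enum) Prod.fst
    (one_le_chainSysWt hd enum) hload
  -- the chain `v k = m_k(z)`
  obtain ⟨v, hv⟩ : ∃ v : ℕ → Fin (N + 1) → L, v = fun k m => eval z (chainPt p q B k m) :=
    ⟨_, rfl⟩
  have hv0 : v 0 = p := by
    rw [hv]; funext m; dsimp only; rw [chainPt_zero, eval_C]
  have hvmid : ∀ k, 1 ≤ k → ∀ hk : k - 1 < B, v k = fun m => z (⟨k - 1, hk⟩, m) := by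
    intro k hk hkB
    rw [hv]; funext m; dsimp only; rw [chainPt_mid p q hk hkB, eval_X]
  have hvB : v (B + 1) = q := by
    rw [hv]; funext m; dsimp only; rw [chainPt_last p q le_rfl, eval_C]
  -- every `F_a` vanishes at every point of the chain
  have hFv : ∀ k ≤ B + 1, ∀ a, eval (v k) (F a) = 0 := by
    intro k hk a
    rcases Nat.eq_zero_or_pos k with rfl | hk1
    · rw [hv0]; exact hp a
    by_cases hkB : k - 1 < B
    · have h := hzQ (⟨k - 1, hkB⟩, Sum.inl a)
      change eval z (aeval (fun m => X ((⟨k - 1, hkB⟩ : Fin B), m)) (F a)) = 0 at h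
      rw [eval_aeval_eq_eval_comp] at h
      rw [hvmid k hk1 hkB]
      simpa using h
    · have hk' : k = B + 1 := by omega
      subst hk'
      rw [hvB]; exact hq a
  -- every mixed equation of every link vanishes
  have hmixv : ∀ i ≤ B, ∀ τ, eval z (mixedEq F d p q B i τ) = 0 := by
    intro i hi τ
    by_cases hle : i ≤ (enum τ : ℕ)
    · have hiB : i < B := by have := (enum τ).isLt; omega
      have h := hzQ (⟨i, hiB⟩, Sum.inr (some τ))
      change eval z (if ((⟨i, hiB⟩ : Fin B) : ℕ) ≤ enum τ then mixedEq F d p q B (⟨i, hiB⟩ : Fin B) τ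
        else mixedEq F d p q B ((⟨i, hiB⟩ : Fin B) + 1) τ) = 0 at h
      rwa [if_pos hle] at h
    · have hi1 : 1 ≤ i := by omega
      have hiB : i - 1 < B := by omega
      by_cases hlt : (enum τ : ℕ) < i - 1
      · have h := hzQ (⟨i - 1, hiB⟩, Sum.inr (some τ))
        change eval z (if ((⟨i - 1, hiB⟩ : Fin B) : ℕ) ≤ enum τ then
          mixedEq F d p q B (⟨i - 1, hiB⟩ : Fin B) τ
          else mixedEq F d p q B ((⟨i - 1, hiB⟩ : Fin B) + 1) τ) = 0 at h
        rw [if_neg (by change ¬ (i - 1 ≤ (enum τ : ℕ)); omega)] at h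
        change eval z (mixedEq F d p q B (i - 1 + 1) τ) = 0 at h
        rwa [Nat.sub_add_cancel hi1] at h
      · have heq : (enum τ : ℕ) = i - 1 := by omega
        have hδ : i - 1 < δt := by rw [← heq]; exact (enum τ).isLt
        have h := hzQ (⟨i - 1, hiB⟩, Sum.inr none)
        change eval z (if h : ((⟨i - 1, hiB⟩ : Fin B) : ℕ) < δt then
          mixedEq F d p q B ((⟨i - 1, hiB⟩ : Fin B) + 1) (enum.symm ⟨(⟨i - 1, hiB⟩ : Fin B), h⟩)
          else 0) = 0 at h
        rw [dif_pos (by simpa using hδ)] at h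
        have hτ : enum.symm ⟨i - 1, hδ⟩ = τ := by
          rw [Equiv.symm_apply_eq]; exact Fin.ext heq.symm
        change eval z (mixedEq F d p q B (i - 1 + 1) (enum.symm ⟨i - 1, hδ⟩)) = 0 at h
        rw [hτ, Nat.sub_add_cancel hi1] at h
        exact h
  -- assemble
  refine ⟨v, hv0, hvB, fun j hj => ?_, fun j hj a s t => ?_⟩
  · rcases Nat.eq_zero_or_pos j with rfl | hj1
    · rw [hv0]; exact hp0
    by_cases hjB : j - 1 < B
    · rw [hvmid j hj1 hjB]
      obtain ⟨w, hw, hwz⟩ := hzblk ⟨j - 1, hjB⟩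
      intro h0
      apply hwz
      have := congrFun h0 w.2
      rwa [show (⟨j - 1, hjB⟩, w.2) = w from Prod.ext hw.symm rfl] at this
    · have hj' : j = B + 1 := by omega
      subst hj'
      rw [hvB]; exact hq0
  · have h := eval_smul_add_smul_eq_zero_of_coeff (chainPt p q B j) (chainPt p q B (j + 1)) (hF a)
      z (fun e he0 he1 => ?_) ?_ ?_ s t
    · rw [hv]
      have hfun : ((s • fun m => eval z (chainPt p q B j m)) + t • fun m => eval z (chainPt p q B (j + 1) m)) =
          fun m => s * eval z (chainPt p q B j m) + t * eval z (chainPt p q B (j + 1) m) := by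
        funext m; simp [Pi.add_apply, Pi.smul_apply, smul_eq_mul]
      rw [hfun]; exact h
    · -- the mixed coefficient `e = (d_a - 1 - j', j' + 1)`, `j' = e 1 - 1`
      by_cases hdeg : e 0 + e 1 = d a
      · have hj'lt : e 1 - 1 < d a - 1 := by omega
        have h := hmixv j hj ⟨a, ⟨e 1 - 1, hj'lt⟩⟩
        have he : Finsupp.single (0 : Fin 2) (d a - 1 - (e 1 - 1)) +
            Finsupp.single 1 (e 1 - 1 + 1) = e := by
          ext k; fin_cases k
          · simp; omega
          · simp; omega
        unfold mixedEq at h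
        rwa [he] at h
      · have hcoeff : coeff e (twoPointSubst (chainPt p q B j) (chainPt p q B (j + 1)) (F a)) = 0 := by
          refine (isHomogeneous_twoPointSubst _ _ (hF a)).coeff_eq_zero ?_
          rw [Finsupp.degree_eq_sum, Fin.sum_univ_two]; exact hdeg
        rw [hcoeff, map_zero]
    · have := hFv j (by omega) a
      rwa [hv] at this
    · have := hFv (j + 1) (by omega) a
      rwa [hv] at this

/-- **Chain connectedness by lines, in coordinates** (Kollár V.4.8.1 for `Σ d_a ≤ N - 1`, over an
algebraically closed field, for every `V₊(F)`): if `F_a` are forms of degrees `d_a ≥ 1` in `N + 1`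
variables with `Σ_a d_a + 1 ≤ N`, any two non-zero common zeros `p, q` are joined by a chain
`p = v_0, v_1, …, v_{r+1} = q` of non-zero vectors with every `F_a` vanishing identically on each
span `s·v_j + t·v_{j+1}` — with `r = Σ_a (d_a - 1) + 1`. The chain is a common zero of the
multihomogeneous system of the links on `(ℙᴺ)^r`, which exists by the multihomogeneous Bézout
existence theorem. [cite: TianZong2014, proof of Thm. 6.1 (first sentence)] -/
theorem exists_chain_of_sum_deg_le {F : Fin c → MvPolynomial (Fin (N + 1)) L} {d : Fin c → ℕ}
    (hF : ∀ a, (F a).IsHomogeneous (d a)) (hd : ∀ a, 0 < d a) (hN : ∑ a, d a + 1 ≤ N)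
    (p q : Fin (N + 1) → L) (hp0 : p ≠ 0) (hq0 : q ≠ 0)
    (hp : ∀ a, eval p (F a) = 0) (hq : ∀ a, eval q (F a) = 0) :
    ∃ (r : ℕ) (v : ℕ → Fin (N + 1) → L), v 0 = p ∧ v (r + 1) = q ∧ (∀ j ≤ r + 1, v j ≠ 0) ∧
      ∀ j ≤ r, ∀ a (s t : L), eval (s • v j + t • v (j + 1)) (F a) = 0 := by
  obtain ⟨v, h⟩ := exists_chain_of_sum_deg_le_length hF hd hN p q hp0 hq0 hp hq
  exact ⟨_, v, h⟩

end Chain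

end Literature.RingTheory.MvPolynomial

end
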